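import Summits.PneNP.PneNP.Theorems.ConvexRankGatesConvexGateBlindExactLiftingTriangleLineCover

/-!
# Triangle instance — the MONO-HEAVINESS calculus, I: the heavy-atom theorem (lead c6)

Support file for crux `ConvexGateBlind` (stmt-PneNP-10680), line `xor-door-perfect-completeness`, open stub
`stub_exactLifting`; instance of record the triangle matrix `M_t[x,w] = monoCount x w = 1 + 2·[w monochromatic]`
(`…TriangleLineCover`), open question of record `rk₊₊(M_t) = lim_{ε→0⁺} rk₊(M_t − εJ) ∈ [3t² − 3t + 1, t³ + 1]`.

Every lower bound on `rk₊(M_t − εJ)` in the tree is either `ε`-DEPENDENT (mass `ε¹¹t³`, Theorem A; functionals,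
capped at `3t² + εt³` by `…FunctionalCap`) or lives in a sub-model (line-supported atoms `…TriangleLine`; rows near the
line pattern, Theorem B `…TriangleIsolation`; degree-2 rows with interaction-free columns, `…TriangleDegreeTwoBlind`,
again `ε`-dependent).  This file and its sequel `…TriangleTwoDirBlind` record the one handle found so far that is BOTH
`ε`-uniform AND a statement about a single atom of an arbitrary factorisation — a counting interface:

* §1  For a BALANCED colouring `x` (each block half `true`, half `false`) the signed count
  `sgn x = 𝟙[Mono_x] − 𝟙[Non_x]` has line sums `0` on `x`-monochromatic lines and `−t` on bichromatic ones
  (`sum_sgn_line12/13/23`); hence `∑_w sgn x w · monoCount x w = 0`, `2 ∑_w sgn x w = −t³`, and the shifted row is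
  heavy by exactly `εt³/2` (`heav_row`).  (This is Theorem B's cube-inequality dual `ψ^x`, which for balanced `x`
  carries no weights.)
* §2  **Heavy-atom theorem** (`exists_monoHeavy_term`).  If `monoCount x · − ε = ∑_l u_l · v_l` with `u ≥ 0` and
  `ε > 0` at a balanced `x`, then some term with `u_l > 0` is MONO-HEAVY at `x`: `v_l(Mono_x) > v_l(Non_x)`.  No
  hypothesis on the atoms `v_l` (not even non-negativity), none on the number of terms, and the conclusion does not
  degrade as `ε → 0⁺`: every balanced row of every non-negative factorisation of `M_t − εJ` must be SERVED by a
  Mono-heavy atom.  A point atom `δ_w` is heavy for a quarter of the balanced rows, so the interface says nothing by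
  itself; its force comes from classes of atoms that are heavy for few rows or none (the sequel: two-directional
  non-negative atoms and interaction-free atoms vanishing on a plane are NEVER heavy ⇒ ε-uniform blindness; memo
  `ExactLifting-c6.md` on the item: the conjectural LEMMA N / THEOREM C for interaction-free atoms and the
  interaction-budget mechanism for general factorisations).

Nothing here is cited; everything is elementary.
-/

set_option linter.dupNamespace false -- `Summit.PneNP.PneNP.…`: summit = sub-problem (D-0017)

namespace Summit.PneNP.PneNP.Theorems.XorDoor.TriLine.Heavy

open Finset

noncomputable section

variable {t : ℕ}

/-! ## §1 Balanced colourings and the signed count -/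

/-- A block colouring is balanced: as many `true` as `false` vertices. -/
def BalBlock (y : Fin t → Bool) : Prop := #(cls y true) = #(cls y false)

/-- A colouring of the three blocks is balanced when each block is. -/
def Balanced (x : Col t) : Prop := BalBlock x.1 ∧ BalBlock x.2.1 ∧ BalBlock x.2.2

/-- The signed count: `+1` on monochromatic triangles, `−1` on the others. -/
def sgn (x : Col t) (w : Tri t) : ℝ := if IsMono x w.1 w.2.1 w.2.2 then 1 else -1

/-- The heaviness of `v` at `x`: `v(Mono_x) − v(Non_x)`. -/
def heav (x : Col t) (v : Tri t → ℝ) : ℝ := ∑ w, sgn x w * v w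

/-- `v` is Mono-heavy at `x`: it has more mass on the monochromatic triangles than on the others. -/
def MonoHeavy (x : Col t) (v : Tri t → ℝ) : Prop := 0 < heav x v

/-- in a balanced block every colour class has the same size as its complement -/
lemma BalBlock.card_eq {y : Fin t → Bool} (hy : BalBlock y) (c : Bool) : #(cls y c) = #(cls y (!c)) := by
  cases c
  · exact hy.symm
  · exact hy

/-- in a balanced block every colour class has `t/2` elements: `2 · #cls = t` -/
lemma BalBlock.two_mul_card {y : Fin t → Bool} (hy : BalBlock y) (c : Bool) : 2 * (#(cls y c) : ℝ) = t := by
  have h := card_cls_add_card_cls_not y c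
  rw [← hy.card_eq c] at h
  have : ((#(cls y c) + #(cls y c) : ℕ) : ℝ) = (t : ℝ) := by exact_mod_cast h
  push_cast at this
  linarith

/-- the `±1` sum over a balanced block vanishes -/
lemma BalBlock.sum_pm {y : Fin t → Bool} (hy : BalBlock y) (c : Bool) :
    ∑ d, (if c = y d then (1 : ℝ) else -1) = 0 := by
  rw [Finset.sum_ite]
  simp only [sum_const]
  have h1 : (univ.filter fun d => c = y d) = cls y c := by
    ext d; simp [cls, eq_comm]
  have h2 : (univ.filter fun d => ¬ c = y d) = cls y (!c) := by
    ext d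
    simp only [mem_filter, mem_univ, true_and, mem_cls]
    cases y d <;> cases c <;> simp
  rw [h1, h2, ← hy.card_eq c]
  ring

/-- the indicator of the other colour sums to `t/2` over a balanced block -/
lemma BalBlock.sum_ind {y : Fin t → Bool} (hy : BalBlock y) (c : Bool) :
    ∑ d, (if c = y d then (0 : ℝ) else 1) = t / 2 := by
  rw [Finset.sum_ite]
  simp only [sum_const_zero, zero_add, sum_const, nsmul_eq_mul, mul_one]
  have h2 : (univ.filter fun d => ¬ c = y d) = cls y (!c) := by
    ext d
    simp only [mem_filter, mem_univ, true_and, mem_cls]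
    cases y d <;> cases c <;> simp
  rw [h2, ← hy.card_eq c]
  linarith [hy.two_mul_card c]

variable {x : Col t}

/-- line sum of the signed count in the third direction: `0` on a monochromatic pair `(a,b)`, `−t` otherwise -/
lemma sum_sgn_line12 (hx : Balanced x) (a b : Fin t) :
    ∑ d, sgn x (a, b, d) = -(t : ℝ) * (if x.1 a = x.2.1 b then 0 else 1) := by
  by_cases h : x.1 a = x.2.1 b
  · rw [if_pos h, mul_zero]
    have : ∀ d, sgn x (a, b, d) = if x.1 a = x.2.2 d then 1 else -1 := by
      intro d; simp [sgn, IsMono, h]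
    simp_rw [this]
    exact hx.2.2.sum_pm (x.1 a)
  · rw [if_neg h, mul_one]
    have : ∀ d, sgn x (a, b, d) = -1 := by
      intro d; simp [sgn, IsMono, h]
    simp [this]

/-- line sum in the second direction -/
lemma sum_sgn_line13 (hx : Balanced x) (a d : Fin t) :
    ∑ b, sgn x (a, b, d) = -(t : ℝ) * (if x.1 a = x.2.2 d then 0 else 1) := by
  by_cases h : x.1 a = x.2.2 d
  · rw [if_pos h, mul_zero]
    have : ∀ b, sgn x (a, b, d) = if x.1 a = x.2.1 b then 1 else -1 := by
      intro b; simp [sgn, IsMono, h]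
    simp_rw [this]
    exact hx.2.1.sum_pm (x.1 a)
  · rw [if_neg h, mul_one]
    have : ∀ b, sgn x (a, b, d) = -1 := by
      intro b; simp [sgn, IsMono, h]
    simp [this]

/-- line sum in the first direction -/
lemma sum_sgn_line23 (hx : Balanced x) (b d : Fin t) :
    ∑ a, sgn x (a, b, d) = -(t : ℝ) * (if x.2.1 b = x.2.2 d then 0 else 1) := by
  by_cases h : x.2.1 b = x.2.2 d
  · rw [if_pos h, mul_zero]
    have : ∀ a, sgn x (a, b, d) = if x.2.1 b = x.1 a then 1 else -1 := by
      intro a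
      simp only [sgn, IsMono]
      by_cases h' : x.2.1 b = x.1 a
      · rw [if_pos h', if_pos ⟨h'.symm, h'.symm.trans h⟩]
      · rw [if_neg h', if_neg (fun hh => h' hh.1.symm)]
    simp_rw [this]
    exact hx.1.sum_pm (x.2.1 b)
  · rw [if_neg h, mul_one]
    have : ∀ a, sgn x (a, b, d) = -1 := by
      intro a
      simp only [sgn]
      rw [if_neg]
      rintro ⟨h1, h2⟩
      exact h (h1.symm.trans h2)
    simp [this]

/-- `heav` as an iterated sum -/
lemma heav_eq_sum3 (v : Tri t → ℝ) : heav x v = ∑ a, ∑ b, ∑ d, sgn x (a, b, d) * v (a, b, d) := by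
  simp only [heav, Fintype.sum_prod_type]

/-- the signed count kills `monoCount`: `∑_w sgn x w · monoCount x w = 0` (each pair-agreement indicator is a union of
monochromatic lines) -/
lemma sum_sgn_mul_monoCount (hx : Balanced x) : heav x (fun w => (monoCount x w : ℝ)) = 0 := by
  rw [heav_eq_sum3]
  have hmc : ∀ a b d, (monoCount x (a, b, d) : ℝ) = (if x.1 a = x.2.1 b then 1 else 0) +
      (if x.1 a = x.2.2 d then 1 else 0) + (if x.2.1 b = x.2.2 d then 1 else 0) := by
    intro a b d
    simp only [monoCount]
    push_cast
    rfl
  simp_rw [hmc, mul_add, sum_add_distrib]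
  have h1 : ∑ a, ∑ b, ∑ d, sgn x (a, b, d) * (if x.1 a = x.2.1 b then (1 : ℝ) else 0) = 0 := by
    refine sum_eq_zero fun a _ => sum_eq_zero fun b _ => ?_
    rw [← sum_mul, sum_sgn_line12 hx]
    split_ifs <;> simp
  have h2 : ∑ a, ∑ b, ∑ d, sgn x (a, b, d) * (if x.1 a = x.2.2 d then (1 : ℝ) else 0) = 0 := by
    refine sum_eq_zero fun a _ => ?_
    rw [sum_comm]
    refine sum_eq_zero fun d _ => ?_
    rw [← sum_mul, sum_sgn_line13 hx]
    split_ifs <;> simp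
  have h3 : ∑ a, ∑ b, ∑ d, sgn x (a, b, d) * (if x.2.1 b = x.2.2 d then (1 : ℝ) else 0) = 0 := by
    rw [sum_comm]
    refine sum_eq_zero fun b _ => ?_
    rw [sum_comm]
    refine sum_eq_zero fun d _ => ?_
    rw [← sum_mul, sum_sgn_line23 hx]
    split_ifs <;> simp
  rw [h1, h2, h3]; ring

/-- the total signed count of a balanced colouring: `2 ∑_w sgn x w = −t³` -/
lemma two_mul_sum_sgn (hx : Balanced x) : 2 * heav x (fun _ => (1 : ℝ)) = -(t : ℝ) ^ 3 := by
  rw [heav_eq_sum3]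
  simp_rw [mul_one]
  have h1 : ∀ a, ∑ b, ∑ d, sgn x (a, b, d) = -(t : ℝ) * (t / 2) := by
    intro a
    simp_rw [sum_sgn_line12 hx, ← mul_sum]
    rw [hx.2.1.sum_ind (x.1 a)]
  simp_rw [h1]
  simp only [sum_const, card_univ, Fintype.card_fin, nsmul_eq_mul]
  ring

/-- `heav` is linear: the heaviness of a conic combination is the combination of the heavinesses -/
lemma heav_sum_mul {D : ℕ} (u : Fin D → ℝ) (v : Fin D → Tri t → ℝ) :
    heav x (fun w => ∑ l, u l * v l w) = ∑ l, u l * heav x (v l) := by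
  simp only [heav, mul_sum]
  rw [sum_comm]
  refine sum_congr rfl fun l _ => sum_congr rfl fun w _ => ?_
  ring

/-- `heav` of a difference with a constant -/
lemma heav_sub_const (v : Tri t → ℝ) (ε : ℝ) :
    heav x (fun w => v w - ε) = heav x v - ε * heav x (fun _ => (1 : ℝ)) := by
  simp only [heav, mul_sub, sum_sub_distrib, mul_one, mul_sum]
  congr 1
  exact sum_congr rfl fun w _ => by ring

/-- **The row is heavy, by exactly `εt³/2`.** -/
theorem heav_row (hx : Balanced x) (ε : ℝ) :
    heav x (fun w => (monoCount x w : ℝ) - ε) = ε * (t : ℝ) ^ 3 / 2 := by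
  rw [heav_sub_const, sum_sgn_mul_monoCount hx]
  have h2 := two_mul_sum_sgn hx
  have hh : heav x (fun _ => (1 : ℝ)) = -(t : ℝ) ^ 3 / 2 := by linarith
  rw [hh]; ring

/-! ## §2 The heavy-atom theorem -/

/-- **Heavy-atom theorem (ε-uniform).**  At a balanced colouring `x`, if the shifted row `monoCount x · − ε`
(`ε > 0`, `t ≥ 1`) is a combination `∑_l u_l · v_l` with non-negative coefficients, then some term with `u_l > 0`
is Mono-heavy at `x`.  Nothing is assumed about the atoms `v_l` or the number of terms. -/
theorem exists_monoHeavy_term (ht : 1 ≤ t) (hx : Balanced x) {ε : ℝ} (hε : 0 < ε) {D : ℕ}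
    (u : Fin D → ℝ) (v : Fin D → Tri t → ℝ) (hu : ∀ l, 0 ≤ u l)
    (hrow : ∀ w, (monoCount x w : ℝ) - ε = ∑ l, u l * v l w) :
    ∃ l, 0 < u l ∧ MonoHeavy x (v l) := by
  have hpos : 0 < heav x (fun w => (monoCount x w : ℝ) - ε) := by
    rw [heav_row hx]
    have : (0 : ℝ) < t := by exact_mod_cast ht
    positivity
  have heq : heav x (fun w => (monoCount x w : ℝ) - ε) = ∑ l, u l * heav x (v l) := by
    rw [← heav_sum_mul]
    simp only [heav, hrow]
  rw [heq] at hpos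
  obtain ⟨l, -, hl⟩ := exists_lt_of_sum_lt (by simpa using hpos : ∑ _l : Fin D, (0 : ℝ) < ∑ l, u l * heav x (v l))
  rcases pos_and_pos_or_neg_and_neg_of_mul_pos hl with ⟨h1, h2⟩ | ⟨h1, -⟩
  · exact ⟨l, h1, h2⟩
  · exact absurd h1 (not_lt.2 (hu l))

/-- **Heavy-atom theorem, registered form** (sub-goal `triangle_heavy_atom` of stmt-PneNP-10680): at a balanced
colouring, every combination `monoCount x · − ε = ∑_l u_l · v_l` with `u ≥ 0`, `ε > 0` has a Mono-heavy term. -/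
theorem triangle_heavy_atom : ∀ {t : ℕ} {x : Col t}, 1 ≤ t → Balanced x → ∀ {ε : ℝ}, 0 < ε → ∀ {D : ℕ} (u : Fin D → ℝ) (v : Fin D → Tri t → ℝ), (∀ l, 0 ≤ u l) → (∀ w, (monoCount x w : ℝ) - ε = ∑ l, u l * v l w) → ∃ l, 0 < u l ∧ MonoHeavy x (v l) :=
  fun ht hx _ hε _ u v hu hrow => exists_monoHeavy_term ht hx hε u v hu hrow

end

end Summit.PneNP.PneNP.Theorems.XorDoor.TriLine.Heavy
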